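import Summits.QuantumFields.YangMills.Theorems.BalabanUVNodesN15KingModelFullPropagatorGradHolderSlice
import Summits.QuantumFields.YangMills.Theorems.BalabanUVNodesN15KingModelFullPropagatorGradProfile
import Literature.MathematicalPhysics.QuantumFieldTheory.King1986.PropagatorDerivHolderSupNorm

/-!
# BalabanUVNodes ∕ N15 — THE KING-MODEL RUNG, CURVED EDITION (PART U-b): THE C^{1,α} PROFILE OF THE FULL `A = 0` FLUCTUATION PROPAGATOR AT THE
# KERNEL LEVEL — `(|x − x′|∕L^K)^{−α}·|∂^η_μG^η_K(x′, y) − ∂^η_μG^η_K(x, y)| ≤ C·Σ_{i<K} (ΛL)^i(L^i)^α·e^{−δ·m·L^i∕L^K}` for ALL `x, x′, y`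
# (`m = dist({x, x′}, y)`), UNIFORMLY in `K`, the volume and the mass — King's Prop. 3.7 (3.65) DERIVATIVE clause summed over (2.17)
# (Track A, DAG node N15 = NE2; FAN-OUT v1.1 §N15 s3 «KING-MODEL RUNG … + the one-line statement of what the curved case adds»)

HONEST FRAMING.  Count-neutral kernel bookkeeping (cell `pub-ymgap`, seat `pub-ymgap-dag-n15-e` g9; `--supports stmt-QuantumFields-20544
--as helper` = K3⁷ `SpineGivenEndpointR13SepCoPH`, WORDS-143).  TEMPLATE LITERATURE, `A = 0`: C. King's scalar U(1)-Higgs MODEL on finite tori ([King1986]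
§2.2 p. 653 (2.13)–(2.17), p. 654 (2.20), Theorem 3.3 pp. 655–656 ((3.8) p. 656: «(1∕|x − y|^α)|(∇^ε_AG_k(A)f)(x) − (∇^ε_AG_k(A)f)(y)| ≤ Cexp[−δ₀dist({x,
y}, supp f)]‖f‖», «see [Ba 4]»), (3.62) p. 663, Prop. 3.7 (3.65) p. 663 «|(∂_α(x, y)D^a_xD^b_zG_{(j)})(z)| ≤ C(L^jη)^{2−d−|a|−|b|−α}exp[−δ₀(L^jη)^{−1}dist({x,
y}, z)]»; King's `d` = this file's `d + 1`), NOT Bałaban's covariant objects; the full-propagator C^{1,α} profile below is the (2.17)-SUMMED SHAPE of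
the derivative clause of (3.65) for King's (2.13) at `A = 0`, NOT a printed proposition; NE2⁺ is NOT PRINTED and not proved here; NOT a node
discharge; nothing continuum ∕ ℝ⁴ ∕ OS ∕ mass-gap ∕ Clay.  0 `sorry`, 0 `def`, standard axioms.

THE POINT.  Parts R-a∕R-b∕R-c proved the all-pairs UV profile and power laws of the KERNEL `G(K, M, m²) = constrainedProp (L^K) M (aK a L K) ((L^K)²) m²`
and of its forward η-derivative `∂G_μ(x, y) := L^K·[G(x + e_μ, y) − G(x, y)]` (`|∂G| ≤ C((L^K)∕r)^d`); part T-b proved the HÖLDER clause of the kernel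
itself ((3.65)₁ ∕ (3.8)₁) by a torus walk.  The walk does not give the DERIVATIVE's Hölder clause (a unit step of `∂G` is a second difference, and
`G ∉ C²` in King's model: the averaging term `a_kP_k` of [Ba 4] (1.6) jumps across block faces).  THIS FILE runs the peel induction of part R-c
at TWO observation points `x, x′` and one source `y`:
* bottom level (`K = 1`, `N = L`) = [Ba 4] (1.9) ∕ King (3.8) for the KERNEL of `A₀⁻¹` (point source, factor `L^{d+1}`), mass inside
  (`King1986.Torus.constrainedProp_deriv_holder_blocks_unif` ← `B4Thm19ZeroTorus.thm19_zero_torus_unif`), read in fine distance;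
* slice term = part U-a `ksDSlice_holder_unif` (the Hölder difference of the gradient piece, two single-source decays), read in fine distance;
* weight bookkeeping: the fine distance `ρ = |x − x′|` is PRESERVED by the peel (R-a `tdistT_flatten`), so the Hölder weight in the units of the
  next level is `(ρ∕(N·L))^{−α} = L^α·(ρ∕N)^{−α}` (U-a `div_mul_rpow_neg`): per level the factor is `ΛL·L^α = L^{d+α}`.
RESULT: ★★ **`fullPropD_holder_profile_unif`** — `0 < α < 1`: `∃ C, δ > 0 ∀ K ≥ 1 ∀ N = L^K ∀ cube 2L^e ∀ 0 < m² ≤ m₀² ∀ μ x x′ y,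
(ρ∕N)^{−α}·|∂G_μ(x′, y) − ∂G_μ(x, y)| ≤ C·Σ_{i<K} (ΛL)^i(L^i)^α·exp(−δ·m·L^i∕N)`, `m = min(|x − y|, |x′ − y|)` — ALL points.  The sequel
`…FullPropagatorGradHolderPowerLaw` sums the levels: `≤ C′·((L^K)∕m)^{d+α}`.
WHAT THE CURVED CASE ADDS (one line): the same C^{1,α} kernel profile for `∇_UG_k(U)` uniformly over the live window `Reg335` ([B9] Thm 3.1 (3.43)
p. 398 prints the OPERATOR Hölder entry `‖ζ∇_UGλ‖_β`, `β < 1`; no η-difference is printed).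
HONEST SCOPE.  (i) `A = 0`, periodic b.c., odd `L ≥ 3`, `0 < m² ≤ m₀²`, cubes `2L^e`, `0 < α < 1` ((1.9) is printed «α < 1»; `α = 1` is NOT claimed);
(ii) lattice units of level `K`; sup torus distances; (iii) `K ≥ 1`; (iv) the second difference in the observation point only (no `∇_y`, no mixed
clause); (v) not Bałaban's `∇G_k(U)`; not a discharge.
Locators: [King1986] C. King, CMP **102** (1986) 649–677: (2.13)–(2.17) p. 653, (2.20) p. 654, Theorem 3.3 p. 655, (3.8) p. 656, (3.62), Prop. 3.7
(3.65) p. 663, (4.42)–(4.44) p. 675; [Ba 4] = [Balaban1983RegularityDecay] Theorem (1.9) p. 573.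
-/

noncomputable section

namespace Summit.QuantumFields.YangMills.BalabanUVNodes.N15KingModelRung.Curved

open Real Finset Matrix
open Literature.MathematicalPhysics.QuantumFieldTheory.Balaban1983to89 (Params)
open Literature.MathematicalPhysics.QuantumFieldTheory.Balaban1983to89.B5Prop11Plancherel (Tor fine unitVec)
open Literature.MathematicalPhysics.QuantumFieldTheory.King1986 (aK aK_pos)
open Literature.MathematicalPhysics.QuantumFieldTheory.King1986.Torus (constrainedProp flatten blockOf tdistT
  tdistT_nonneg tdistT_symm constrainedProp_deriv_holder_blocks_unif)

variable {d : ℕ} (L : ℕ) [NeZero L]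

/-! ## The C^{1,α} profile: `(ρ∕N)^{−α}·|∂^η_μG^η_K(x′, y) − ∂^η_μG^η_K(x, y)| ≤ C·Σ_{i<K} (ΛL)^i(L^i)^α·e^{−δ·m·L^i∕N}`, all points -/

/-- **THE C^{1,α} PROFILE OF KING'S FULL `A = 0` FLUCTUATION PROPAGATOR AT THE KERNEL LEVEL** (the Hölder difference, in the observation point, of
the forward η-derivative `∂G_μ(x, y) = L^K·[G^η_K(x + e_μ, y) − G^η_K(x, y)]` of `constrainedProp (L^K) M (aK a L K) ((L^K)²) m²`, level-`K` lattice
units, weight `(|x − x′|∕L^K)^{−α}` = King's `|x − x′|^{−α}` of (3.62) in unit coordinates): for odd `L ≥ 3`, `a > 0`, a mass cap `m₀² ≥ 0` and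
`0 < α < 1` there are `C, δ > 0` (functions of `d, L, a, m₀², α`) such that for EVERY `K ≥ 1` (any spelling `N = L^K`), cube `M_μ = 2L^e`, mass
`0 < m² ≤ m₀²`, direction `μ` and ALL fine points `x, x′, y`:
`(|x − x′|∕N)^{−α}·|∂G_μ(x′, y) − ∂G_μ(x, y)| ≤ C·Σ_{i<K} (ΛL)^i·(L^i)^α·exp(−δ·min(|x − y|, |x′ − y|)·L^i∕N)`, `ΛL = (L^{d+1}∕L²)·L` — the derivative
clause of Prop. 3.7 (3.65) «`C(L^jη)^{1−d−α}exp[−δ₀(L^jη)^{−1}dist({x, y}, z)]`» summed over (2.17), for the FULL propagator, uniformly in `K`.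
Induction on `K`: bottom = [Ba 4] (1.9) with a point source (`constrainedProp_deriv_holder_blocks_unif`, mass inside) read in fine distance; step =
part O-a′'s differentiated peel at the two observation points + part U-a + the induction hypothesis one level down, the weight rescaled by `L^α`.
[cite: King1986, (2.13)–(2.17) p.653, (2.20) p.654, Theorem 3.3 p.655, (3.8) p.656, (3.62) p.663, Prop. 3.7 (3.65) p.663, (4.42)–(4.44) p.675; Balaban1983RegularityDecay, Theorem (1.9) p.573] -/
theorem fullPropD_holder_profile_unif (hLodd : Odd L) (hL : 2 ≤ L) {a : ℝ} (ha : 0 < a) {m0sq : ℝ} (hm0 : 0 ≤ m0sq)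
    {α : ℝ} (hα0 : 0 < α) (hα1 : α < 1) :
    ∃ C δ : ℝ, 0 < C ∧ 0 < δ ∧ ∀ (K : ℕ), 1 ≤ K → ∀ (N : ℕ) [NeZero N], N = L ^ K →
      ∀ (e : ℕ) (M : Fin (d + 1) → ℕ) [∀ μ, NeZero (M μ)], (∀ μ, M μ = 2 * L ^ e) →
      ∀ (msq : ℝ), 0 < msq → msq ≤ m0sq → ∀ (μ : Fin (d + 1)) (x x' y : Tor (fine N M)),
        (tdistT (fine N M) x x' / (N : ℝ)) ^ (-α) *
          |((N : ℝ) * (constrainedProp N M (aK a L K) (((N : ℕ) : ℝ) ^ 2) msq (x' + unitVec (fine N M) μ) y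
              - constrainedProp N M (aK a L K) (((N : ℕ) : ℝ) ^ 2) msq x' y)
            - (N : ℝ) * (constrainedProp N M (aK a L K) (((N : ℕ) : ℝ) ^ 2) msq (x + unitVec (fine N M) μ) y
              - constrainedProp N M (aK a L K) (((N : ℕ) : ℝ) ^ 2) msq x y))|
          ≤ C * ∑ i ∈ Finset.range K, ((L : ℝ) ^ (d + 1) / (L : ℝ) ^ 2 * L) ^ i * ((L : ℝ) ^ i) ^ α
              * Real.exp (-(δ * (min (tdistT (fine N M) x y) (tdistT (fine N M) x' y) * (L : ℝ) ^ i / (N : ℝ)))) := by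
  have hL1 : 1 < L := by omega
  have hLr : (1 : ℝ) ≤ L := by exact_mod_cast hL1.le
  have hL0 : (0 : ℝ) < L := by positivity
  -- the base constants ([Ba 4] (1.9), point source, mass inside) and the slice constants (part U-a)
  obtain ⟨δb, cb, hδb, hcb, Hb⟩ :=
    constrainedProp_deriv_holder_blocks_unif (d + 1) L (by omega) ⟨hLodd, hL1⟩ ha hm0 hα0.le hα1
  obtain ⟨Cs, κ, hCs, hκ, Hs⟩ := ksDSlice_holder_unif (d := d) L hLodd hL ha hm0 hα0 hα1
  -- the constants of the theorem
  set Λ : ℝ := (L : ℝ) ^ (d + 1) / (L : ℝ) ^ 2 * L with hΛdef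
  have hΛ : 0 < Λ := by positivity
  have hLα : 0 < (L : ℝ) ^ α := Real.rpow_pos_of_pos hL0 α
  set δ : ℝ := min δb κ with hδdef
  have hδ : 0 < δ := lt_min hδb hκ
  have hδb' : δ ≤ δb := min_le_left _ _
  have hδκ : δ ≤ κ := min_le_right _ _
  set C : ℝ := max ((L : ℝ) ^ (d + 1) * cb * Real.exp δb) (Λ * (L : ℝ) ^ α * (2 * Cs * Real.exp κ)) with hCdef
  have hC : 0 < C := lt_max_of_lt_right (by positivity)
  have hCb : (L : ℝ) ^ (d + 1) * cb * Real.exp δb ≤ C := le_max_left _ _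
  have hCsC : Λ * (L : ℝ) ^ α * (2 * Cs * Real.exp κ) ≤ C := le_max_right _ _
  refine ⟨C, δ, hC, hδ, ?_⟩
  intro K hK
  induction K, hK using Nat.le_induction with
  | base =>
    -- `K = 1`: (1.9) with a point source, block currency, read in fine distance
    intro N _ hN e M _ hM msq hmsq hcap μ x x' y
    subst hN
    set P : Params := ⟨d + 1, L, e, 1, by omega, ⟨hLodd, hL1⟩⟩ with hPdef
    have hMK : ∀ μ, M μ = P.sitesPerDir P.K := fun μ => by
      rw [hM μ]
      simp [hPdef, Params.sitesPerDir]
    set r : ℝ := tdistT (fine (L ^ 1) M) x y with hrdef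
    set r' : ℝ := tdistT (fine (L ^ 1) M) x' y with hr'def
    set m : ℝ := min r r' with hmdef
    have hN1 : ((L ^ 1 : ℕ) : ℝ) = L := by push_cast; ring
    rw [Finset.sum_range_one, pow_zero, pow_zero, Real.one_rpow, one_mul, one_mul, mul_one]
    conv_rhs => rw [hN1]
    by_cases hxx : x' = x
    · -- equal observation points: the difference vanishes
      rw [hxx, sub_self, abs_zero, mul_zero]
      positivity
    have h := Hb P rfl rfl le_rfl msq hmsq.le hcap M hMK (L ^ 1) rfl x x' y hxx μ
    have hcast : (((L ^ 1 : ℕ) : ℝ)) ^ P.d * cb = (L : ℝ) ^ (d + 1) * cb := by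
      simp [hPdef]
    rw [hcast] at h
    set D : ℝ := tdistT M (blockOf (L ^ 1) M x) (blockOf (L ^ 1) M y) with hDdef
    set D' : ℝ := tdistT M (blockOf (L ^ 1) M x') (blockOf (L ^ 1) M y) with hD'def
    have hfine : r ≤ (L : ℝ) * D + ((L : ℝ) - 1) := by
      have h' := tdistT_fine_le_blocks (L ^ 1) M x y
      rwa [hN1] at h'
    have hfine' : r' ≤ (L : ℝ) * D' + ((L : ℝ) - 1) := by
      have h' := tdistT_fine_le_blocks (L ^ 1) M x' y
      rwa [hN1] at h'
    have hmr : m ≤ r := min_le_left _ _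
    have hmr' : m ≤ r' := min_le_right _ _
    have hexp_m : ∀ {s : ℝ}, m ≤ s → Real.exp (-(δ * (s / L))) ≤ Real.exp (-(δ * (m / L))) := fun hms =>
      Real.exp_le_exp.mpr (neg_le_neg (mul_le_mul_of_nonneg_left (div_le_div_of_nonneg_right hms hL0.le) hδ.le))
    have hexp : Real.exp (-(δb * min D D')) ≤ Real.exp δb * Real.exp (-(δ * (m / L))) := by
      rcases min_choice D D' with hmin | hmin
      · rw [hmin]
        exact (exp_block_decay_le hLr le_rfl (tdistT_nonneg _ x y) hδ.le hδb' hfine).trans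
          (mul_le_mul_of_nonneg_left (hexp_m hmr) (Real.exp_pos _).le)
      · rw [hmin]
        exact (exp_block_decay_le hLr le_rfl (tdistT_nonneg _ x' y) hδ.le hδb' hfine').trans
          (mul_le_mul_of_nonneg_left (hexp_m hmr') (Real.exp_pos _).le)
    calc _ ≤ (L : ℝ) ^ (d + 1) * cb * Real.exp (-(δb * min D D')) := h
      _ ≤ (L : ℝ) ^ (d + 1) * cb * (Real.exp δb * Real.exp (-(δ * (m / L)))) :=
          mul_le_mul_of_nonneg_left hexp (by positivity)
      _ = (L : ℝ) ^ (d + 1) * cb * Real.exp δb * Real.exp (-(δ * (m / L))) := by ring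
      _ ≤ C * Real.exp (-(δ * (m / L))) := mul_le_mul_of_nonneg_right hCb (Real.exp_pos _).le
  | succ K hK IH =>
    intro N _ hN e M _ hM msq hmsq hcap μ xf xf' yf
    subst hN
    obtain rfl : M = fun _ => 2 * L ^ e := funext hM
    set i : KSliceIdx d := ⟨e, K, hK, 1, le_rfl, 0, Nat.zero_le e, 1, le_rfl⟩ with hidef
    obtain ⟨x, rfl⟩ := (flatten (L ^ K) L (ksM L i)).surjective xf
    obtain ⟨x', rfl⟩ := (flatten (L ^ K) L (ksM L i)).surjective xf'
    obtain ⟨y, rfl⟩ := (flatten (L ^ K) L (ksM L i)).surjective yf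
    -- the fine distances (preserved by the peel) and the block distances one level down
    set ρ : ℝ := tdistT (fine (L ^ K) (ksU L i)) x x' with hρdef
    set r : ℝ := tdistT (fine (L ^ K) (ksU L i)) x y with hrdef
    set r' : ℝ := tdistT (fine (L ^ K) (ksU L i)) x' y with hr'def
    set m : ℝ := min r r' with hmdef
    set Dsub : ℝ := tdistT (ksU L i) (blockOf (L ^ K) (ksU L i) x) (blockOf (L ^ K) (ksU L i) y) with hDsubdef
    set Dsub' : ℝ := tdistT (ksU L i) (blockOf (L ^ K) (ksU L i) x') (blockOf (L ^ K) (ksU L i) y) with hDsub'def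
    set NK : ℝ := ((L ^ K : ℕ) : ℝ) with hNKdef
    have hNK1 : 1 ≤ NK := by
      rw [hNKdef]
      exact_mod_cast Nat.one_le_pow K L (by omega)
    have hNK0 : 0 < NK := by linarith
    have hNKL : NK ≤ NK * L := le_mul_of_one_le_right hNK0.le hLr
    have hcastN : ((L ^ K * L : ℕ) : ℝ) = NK * L := by rw [hNKdef]; push_cast; ring
    have hρ0 : 0 ≤ ρ := tdistT_nonneg _ x x'
    have hr0 : 0 ≤ r := tdistT_nonneg _ x y
    have hr'0 : 0 ≤ r' := tdistT_nonneg _ x' y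
    have hfine : r ≤ NK * Dsub + (NK - 1) := tdistT_fine_le_blocks (L ^ K) (ksU L i) x y
    have hfine' : r' ≤ NK * Dsub' + (NK - 1) := tdistT_fine_le_blocks (L ^ K) (ksU L i) x' y
    have hmr : m ≤ r := min_le_left _ _
    have hmr' : m ≤ r' := min_le_right _ _
    -- the mass one level down
    have hL2 : (0 : ℝ) < (L : ℝ) ^ 2 := by positivity
    have hm2 : 0 < msq / (L : ℝ) ^ 2 := div_pos hmsq hL2
    have hm2cap : msq / (L : ℝ) ^ 2 ≤ m0sq := by
      have h1 : (1 : ℝ) ≤ (L : ℝ) ^ 2 := one_le_pow₀ hLr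
      exact (div_le_self hmsq.le h1).trans hcap
    -- the weight at the finer level
    set w : ℝ := (ρ / NK) ^ (-α) with hwdef
    have hw0 : 0 ≤ w := Real.rpow_nonneg (div_nonneg hρ0 hNK0.le) _
    -- the two η-derivatives one level down and the slice difference
    set A : ℝ := ((L ^ K : ℕ) : ℝ) *
            (constrainedProp (L ^ K) (ksU L i) (aK a L K) (((L ^ K : ℕ) : ℝ) ^ 2) (msq / (L : ℝ) ^ 2)
                (x' + unitVec (fine (L ^ K) (ksU L i)) μ) y
              - constrainedProp (L ^ K) (ksU L i) (aK a L K) (((L ^ K : ℕ) : ℝ) ^ 2) (msq / (L : ℝ) ^ 2) x' y)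
          - ((L ^ K : ℕ) : ℝ) *
            (constrainedProp (L ^ K) (ksU L i) (aK a L K) (((L ^ K : ℕ) : ℝ) ^ 2) (msq / (L : ℝ) ^ 2)
                (x + unitVec (fine (L ^ K) (ksU L i)) μ) y
              - constrainedProp (L ^ K) (ksU L i) (aK a L K) (((L ^ K : ℕ) : ℝ) ^ 2) (msq / (L : ℝ) ^ 2) x y) with hAdef
    set S : ℝ := ksDSlice L a (msq / (L : ℝ) ^ 2) i μ x' y - ksDSlice L a (msq / (L : ℝ) ^ 2) i μ x y with hSdef
    -- the induction hypothesis on the finer cube, ALL points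
    have hM' : ∀ μ, ksU L i μ = 2 * L ^ (e + 1) := fun μ => by
      show L * (2 * L ^ e) = 2 * L ^ (e + 1)
      ring
    have hIH : w * |A| ≤ C * ∑ j ∈ Finset.range K, Λ ^ j * ((L : ℝ) ^ j) ^ α * Real.exp (-(δ * (m * (L : ℝ) ^ j / NK))) :=
      IH (L ^ K) rfl (e + 1) (ksU L i) hM' (msq / (L : ℝ) ^ 2) hm2 hm2cap μ x x' y
    -- the slice term: part U-a, read in fine distance at the NEW top scale `NK·L`
    have hS : w * |S| ≤ Cs * (Real.exp (-(κ * Dsub)) + Real.exp (-(κ * Dsub'))) :=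
      Hs (msq / (L : ℝ) ^ 2) hm2 hm2cap i μ x x' y
    have hexp_m : ∀ {s : ℝ}, m ≤ s → Real.exp (-(δ * (s / (NK * L)))) ≤ Real.exp (-(δ * (m / (NK * L)))) := fun hms =>
      Real.exp_le_exp.mpr (neg_le_neg (mul_le_mul_of_nonneg_left
        (div_le_div_of_nonneg_right hms (by positivity)) hδ.le))
    have hexpS : Real.exp (-(κ * Dsub)) ≤ Real.exp κ * Real.exp (-(δ * (m / (NK * L)))) :=
      (exp_block_decay_le hNK1 hNKL hr0 hδ.le hδκ hfine).trans (mul_le_mul_of_nonneg_left (hexp_m hmr) (Real.exp_pos _).le)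
    have hexpS' : Real.exp (-(κ * Dsub')) ≤ Real.exp κ * Real.exp (-(δ * (m / (NK * L)))) :=
      (exp_block_decay_le hNK1 hNKL hr'0 hδ.le hδκ hfine').trans (mul_le_mul_of_nonneg_left (hexp_m hmr') (Real.exp_pos _).le)
    have hS' : w * |S| ≤ 2 * Cs * Real.exp κ * Real.exp (-(δ * (m / (NK * L)))) := by
      calc w * |S| ≤ Cs * (Real.exp (-(κ * Dsub)) + Real.exp (-(κ * Dsub'))) := hS
        _ ≤ Cs * (Real.exp κ * Real.exp (-(δ * (m / (NK * L)))) + Real.exp κ * Real.exp (-(δ * (m / (NK * L))))) :=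
            mul_le_mul_of_nonneg_left (add_le_add hexpS hexpS') hCs.le
        _ = 2 * Cs * Real.exp κ * Real.exp (-(δ * (m / (NK * L)))) := by ring
    -- the peel at the two observation points (part O-a′, by name; types restated in the goal's spelling)
    have hpx' : ((L ^ K * L : ℕ) : ℝ) *
        (constrainedProp (L ^ K * L) (ksM L i) (aK a L (K + 1)) (((L ^ K * L : ℕ) : ℝ) ^ 2) msq
            (flatten (L ^ K) L (ksM L i) x' + unitVec (fine (L ^ K * L) (ksM L i)) μ) (flatten (L ^ K) L (ksM L i) y)
          - constrainedProp (L ^ K * L) (ksM L i) (aK a L (K + 1)) (((L ^ K * L : ℕ) : ℝ) ^ 2) msq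
            (flatten (L ^ K) L (ksM L i) x') (flatten (L ^ K) L (ksM L i) y))
      = Λ * (((L ^ K : ℕ) : ℝ) *
              (constrainedProp (L ^ K) (ksU L i) (aK a L K) (((L ^ K : ℕ) : ℝ) ^ 2) (msq / (L : ℝ) ^ 2)
                  (x' + unitVec (fine (L ^ K) (ksU L i)) μ) y
                - constrainedProp (L ^ K) (ksU L i) (aK a L K) (((L ^ K : ℕ) : ℝ) ^ 2) (msq / (L : ℝ) ^ 2) x' y)
            + ksDSlice L a (msq / (L : ℝ) ^ 2) i μ x' y) :=
      fullPropD_peel L hL ha hmsq i μ x' y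
    have hpx : ((L ^ K * L : ℕ) : ℝ) *
        (constrainedProp (L ^ K * L) (ksM L i) (aK a L (K + 1)) (((L ^ K * L : ℕ) : ℝ) ^ 2) msq
            (flatten (L ^ K) L (ksM L i) x + unitVec (fine (L ^ K * L) (ksM L i)) μ) (flatten (L ^ K) L (ksM L i) y)
          - constrainedProp (L ^ K * L) (ksM L i) (aK a L (K + 1)) (((L ^ K * L : ℕ) : ℝ) ^ 2) msq
            (flatten (L ^ K) L (ksM L i) x) (flatten (L ^ K) L (ksM L i) y))
      = Λ * (((L ^ K : ℕ) : ℝ) *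
              (constrainedProp (L ^ K) (ksU L i) (aK a L K) (((L ^ K : ℕ) : ℝ) ^ 2) (msq / (L : ℝ) ^ 2)
                  (x + unitVec (fine (L ^ K) (ksU L i)) μ) y
                - constrainedProp (L ^ K) (ksU L i) (aK a L K) (((L ^ K : ℕ) : ℝ) ^ 2) (msq / (L : ℝ) ^ 2) x y)
            + ksDSlice L a (msq / (L : ℝ) ^ 2) i μ x y) :=
      fullPropD_peel L hL ha hmsq i μ x y
    have hpeel : ((L ^ K * L : ℕ) : ℝ) *
            (constrainedProp (L ^ K * L) (ksM L i) (aK a L (K + 1)) (((L ^ K * L : ℕ) : ℝ) ^ 2) msq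
                (flatten (L ^ K) L (ksM L i) x' + unitVec (fine (L ^ K * L) (ksM L i)) μ) (flatten (L ^ K) L (ksM L i) y)
              - constrainedProp (L ^ K * L) (ksM L i) (aK a L (K + 1)) (((L ^ K * L : ℕ) : ℝ) ^ 2) msq
                (flatten (L ^ K) L (ksM L i) x') (flatten (L ^ K) L (ksM L i) y))
          - ((L ^ K * L : ℕ) : ℝ) *
            (constrainedProp (L ^ K * L) (ksM L i) (aK a L (K + 1)) (((L ^ K * L : ℕ) : ℝ) ^ 2) msq
                (flatten (L ^ K) L (ksM L i) x + unitVec (fine (L ^ K * L) (ksM L i)) μ) (flatten (L ^ K) L (ksM L i) y)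
              - constrainedProp (L ^ K * L) (ksM L i) (aK a L (K + 1)) (((L ^ K * L : ℕ) : ℝ) ^ 2) msq
                (flatten (L ^ K) L (ksM L i) x) (flatten (L ^ K) L (ksM L i) y))
        = Λ * (A + S) := by
      rw [hpx', hpx, hAdef, hSdef]
      ring
    -- the weight one level up
    have hweight : (tdistT (fine (L ^ K * L) (ksM L i)) (flatten (L ^ K) L (ksM L i) x) (flatten (L ^ K) L (ksM L i) x')
          / ((L ^ K * L : ℕ) : ℝ)) ^ (-α) = (L : ℝ) ^ α * w := by
      rw [tdistT_flatten, hcastN, ← hρdef, hwdef]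
      exact div_mul_rpow_neg hρ0 hNK0 hL0
    -- the level sums
    have hshift : ∀ j : ℕ, Λ ^ (j + 1) * ((L : ℝ) ^ (j + 1)) ^ α * Real.exp (-(δ * (m * (L : ℝ) ^ (j + 1) / (NK * L))))
        = Λ * (L : ℝ) ^ α * (Λ ^ j * ((L : ℝ) ^ j) ^ α * Real.exp (-(δ * (m * (L : ℝ) ^ j / NK)))) := fun j => by
      have he : m * (L : ℝ) ^ (j + 1) / (NK * L) = m * (L : ℝ) ^ j / NK := by
        rw [pow_succ, ← mul_assoc, mul_div_mul_right _ _ hL0.ne']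
      rw [he, pow_succ, pow_succ, Real.mul_rpow (pow_nonneg hL0.le _) hL0.le]
      ring
    have hsum : ∑ j ∈ Finset.range (K + 1), Λ ^ j * ((L : ℝ) ^ j) ^ α * Real.exp (-(δ * (m * (L : ℝ) ^ j / (NK * L))))
        = Real.exp (-(δ * (m / (NK * L))))
          + Λ * (L : ℝ) ^ α * ∑ j ∈ Finset.range K, Λ ^ j * ((L : ℝ) ^ j) ^ α * Real.exp (-(δ * (m * (L : ℝ) ^ j / NK))) := by
      rw [Finset.sum_range_succ', pow_zero, pow_zero, Real.one_rpow, one_mul, one_mul, mul_one, Finset.mul_sum, add_comm]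
      congr 1
      exact Finset.sum_congr rfl fun j _ => hshift j
    -- the goal in the peel's spelling, fine distances through `tdistT_flatten`
    show (tdistT (fine (L ^ K * L) (ksM L i)) (flatten (L ^ K) L (ksM L i) x) (flatten (L ^ K) L (ksM L i) x')
            / ((L ^ K * L : ℕ) : ℝ)) ^ (-α) *
        |((L ^ K * L : ℕ) : ℝ) *
            (constrainedProp (L ^ K * L) (ksM L i) (aK a L (K + 1)) (((L ^ K * L : ℕ) : ℝ) ^ 2) msq
                (flatten (L ^ K) L (ksM L i) x' + unitVec (fine (L ^ K * L) (ksM L i)) μ) (flatten (L ^ K) L (ksM L i) y)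
              - constrainedProp (L ^ K * L) (ksM L i) (aK a L (K + 1)) (((L ^ K * L : ℕ) : ℝ) ^ 2) msq
                (flatten (L ^ K) L (ksM L i) x') (flatten (L ^ K) L (ksM L i) y))
          - ((L ^ K * L : ℕ) : ℝ) *
            (constrainedProp (L ^ K * L) (ksM L i) (aK a L (K + 1)) (((L ^ K * L : ℕ) : ℝ) ^ 2) msq
                (flatten (L ^ K) L (ksM L i) x + unitVec (fine (L ^ K * L) (ksM L i)) μ) (flatten (L ^ K) L (ksM L i) y)
              - constrainedProp (L ^ K * L) (ksM L i) (aK a L (K + 1)) (((L ^ K * L : ℕ) : ℝ) ^ 2) msq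
                (flatten (L ^ K) L (ksM L i) x) (flatten (L ^ K) L (ksM L i) y))|
        ≤ C * ∑ j ∈ Finset.range (K + 1), Λ ^ j * ((L : ℝ) ^ j) ^ α * Real.exp (-(δ *
            (min (tdistT (fine (L ^ K * L) (ksM L i)) (flatten (L ^ K) L (ksM L i) x) (flatten (L ^ K) L (ksM L i) y))
                (tdistT (fine (L ^ K * L) (ksM L i)) (flatten (L ^ K) L (ksM L i) x') (flatten (L ^ K) L (ksM L i) y))
              * (L : ℝ) ^ j / ((L ^ K * L : ℕ) : ℝ))))
    rw [hweight, hpeel, tdistT_flatten, tdistT_flatten, hcastN, ← hrdef, ← hr'def, ← hmdef, hsum, abs_mul, abs_of_nonneg hΛ.le]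
    -- assemble
    set PS : ℝ := ∑ j ∈ Finset.range K, Λ ^ j * ((L : ℝ) ^ j) ^ α * Real.exp (-(δ * (m * (L : ℝ) ^ j / NK))) with hPSdef
    set E : ℝ := Real.exp (-(δ * (m / (NK * L)))) with hEdef
    have hE0 : 0 < E := Real.exp_pos _
    have hAS : w * |A + S| ≤ C * PS + 2 * Cs * Real.exp κ * E := by
      calc w * |A + S| ≤ w * (|A| + |S|) := mul_le_mul_of_nonneg_left (abs_add_le _ _) hw0
        _ = w * |A| + w * |S| := by ring
        _ ≤ C * PS + 2 * Cs * Real.exp κ * E := add_le_add hIH hS'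
    calc (L : ℝ) ^ α * w * (Λ * |A + S|) = Λ * (L : ℝ) ^ α * (w * |A + S|) := by ring
      _ ≤ Λ * (L : ℝ) ^ α * (C * PS + 2 * Cs * Real.exp κ * E) :=
          mul_le_mul_of_nonneg_left hAS (by positivity)
      _ = C * (Λ * (L : ℝ) ^ α * PS) + Λ * (L : ℝ) ^ α * (2 * Cs * Real.exp κ) * E := by ring
      _ ≤ C * (Λ * (L : ℝ) ^ α * PS) + C * E := by
          have := mul_le_mul_of_nonneg_right hCsC hE0.le
          linarith
      _ = C * (E + Λ * (L : ℝ) ^ α * PS) := by ring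

end Summit.QuantumFields.YangMills.BalabanUVNodes.N15KingModelRung.Curved
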